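import Literature.Geometry.MetricGeometry.GromovHausdorffApprox
import Literature.Geometry.MetricGeometry.CompactIsometryGroup
import Mathlib.Topology.MetricSpace.ProperSpace
import Mathlib.Order.Filter.Ultrafilter.Basic
import HarnessLib

/-!
# Pointed Gromov–Hausdorff approximations and pointed Gromov–Hausdorff convergence

Huang–Huang–Wang–Zhu 2026, §2.1 (p. 6), define (following Fukaya 1986 and Fukaya–Yamaguchi 1992)
a *pointed `ε`-(equivariant) Gromov–Hausdorff approximation* `(X, p) → (Y, q)`: a map
`f : B_{1/ε}(p) → B_{1/ε+ε}(q)` with `f(p) = q`, `|d(f x₁, f x₂) - d(x₁, x₂)| ≤ ε` on `B_{1/ε}(p)`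
and `f(B_{1/ε}(p))` `2ε`-dense in `B_{1/ε+ε}(q)` (plus two conditions on the groups, not treated
in this file), and pointed convergence `(Xᵢ, pᵢ) → (X, p)` as "an `εᵢ`-approximation exists with
`εᵢ → 0`". This is the convergence in the first limiting diagram of the printed proof of their
Main Theorem 1 (§4, p. 13: `(M̂ᵢ, p̂ᵢ, Hᵢ) → (ℝˢ × Ŷ, (0, ŷ), H)`, non-compact covers), vendored as
`Literature.Geometry.Riemannian.huangHuangWangZhu2026_fibresOverCircle_four`; the absolute form
adequate for compact spaces is `Literature.Geometry.MetricGeometry.IsGHApprox`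
(`GromovHausdorffApprox.lean`).

This file sets up the pointed theory for general pseudometric spaces.

* §1 `IsPointedGHApprox r ε p q f` — the map part of the printed notion in the customary
  two-parameter form (radius `r` and error `ε` decoupled, as in Burago–Burago–Ivanov's definition
  of pointed convergence): `f p = q`, distortion `≤ ε` on the closed ball `B̄(p, r)`, and every
  point of `B̄(q, r - 2ε)` within `ε` of `f(B̄(p, r))`. With the density radius `r - 2ε` an
  approximation restricts to smaller balls and larger errors (`IsPointedGHApprox.mono`), composes
  (`IsPointedGHApprox.comp`) and has quasi-inverses (`IsPointedGHApprox.exists_quasiInverse`).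
* §2 `IsPointedEpsGHApprox ε p q f` — the printed one-parameter form VERBATIM (radius `1/ε`,
  `2ε`-density in the open ball `B(q, 1/ε + ε)`), and `IsPointedEpsGHApprox.isPointedGHApprox`:
  it is an `(r, 2ε)`-approximation for every `r < 1/ε`. (The converse direction holds up to
  constants on length spaces and is not needed here. On general metric spaces the printed form is
  badly behaved — e.g. `id : (ℕ, 0) → (ℕ, 0)` is not a printed `ε`-approximation when `ε` is
  slightly larger than `1/(n+1)`, `n ≥ 2`, the point `n + 1 ∈ B(0, 1/ε + ε)` being at distance
  `1 > 2ε` from `B(0, 1/ε) = {0, …, n}` — which is why the two-parameter form is taken as primary.)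
* §3 `PointedGHConv p q` — pointed Gromov–Hausdorff convergence of a sequence `(Xᵢ, pᵢ)` to
  `(Y, q)`: for every `r` and `ε > 0`, eventually an `(r, ε)`-approximation exists; implied by
  printed convergence (`PointedGHConv.of_isPointedEpsGHApprox`); constant sequences converge;
  subsequences converge; approximations in the opposite direction
  (`PointedGHConv.eventually_exists_inverse`); the sequential form with `rᵢ → ∞`, `εᵢ → 0`
  (`PointedGHConv.exists_seq`, `pointedGHConv_of_seq`); approximations between two limits of
  one sequence (`PointedGHConv.exists_isPointedGHApprox_of_pointedGHConv`).
* §4 UNIQUENESS OF PROPER LIMITS: an isometric self-map of a proper metric space with a fixed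
  point is onto (`Isometry.surjective_of_properSpace`); arbitrarily good pointed approximations
  between proper spaces in both directions give a pointed isometry
  (`exists_isometryEquiv_of_forall_isPointedGHApprox`, by an ultralimit of the approximations);
  hence two proper pointed limits of one sequence are pointedly isometric
  (`PointedGHConv.exists_isometryEquiv`).
* §5 bridge with the absolute notion for bounded spaces (`IsGHApprox.isPointedGHApprox_update`,
  `IsPointedGHApprox.isGHApprox`).
* §6 the equivariant versions: `IsPointedEquivGHApprox r ε p q f φ ψ` (two-parameter form of the
  printed pointed `ε`-eGHA `(f, φ, ψ)` with `G(r) = {g | d(g p, p) ≤ r}`), the printed form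
  verbatim (`IsPointedEpsEquivGHApprox`) and the implication between them, and pointed
  equivariant convergence `PointedEquivGHConv Γ G p q` of a sequence of isometric actions
  (implied by the printed `d_eGH → 0`, `PointedEquivGHConv.of_isPointedEpsEquivGHApprox`). The
  precompactness theorem of Fukaya–Yamaguchi in this pointed setting (HHWZ Thm 2.1 as printed) is
  the business of a sibling file; its compact case is `EquivariantGHLimit.lean`.

Everything here is a definition with body or a proved theorem; no named facts.

## References

* H. Huang, X.-T. Huang, J. Wang, X. Zhu, *Fibrations, the first Betti number, and almost
  nonnegative Ricci curvature*, arXiv:2605.24380 (2026), §2.1 p. 6; §4 p. 13.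
  [HuangHuangWangZhu2026]
* K. Fukaya, T. Yamaguchi, *The fundamental groups of almost nonnegatively curved manifolds*,
  Ann. of Math. 136 (1992) 253–333, §3.
* D. Burago, Yu. Burago, S. Ivanov, *A Course in Metric Geometry*, AMS GSM 33 (2001), Ch. 8,
  §8.1 (pointed convergence of non-compact spaces via `(r, ε)`-approximations of balls; uniqueness
  of boundedly compact limits).
* A. Petrunin, *Pure Metric Geometry*, SpringerBriefs (2023), Lecture 5 §B 5.7–5.10
  (approximations and almost isometries), §H with Thm. 5.30 (pointed convergence of proper
  spaces), Lecture 6 (ultralimits; a proper pointed limit is the pointed ultralimit).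
-/

noncomputable section

open Metric Set Filter Function

open scoped Topology

namespace Literature.Geometry.MetricGeometry

/-! ### §1. Pointed `(r, ε)`-approximations -/

section Approx

variable {X Y Z : Type*} [PseudoMetricSpace X] [PseudoMetricSpace Y] [PseudoMetricSpace Z]

/-- **Pointed `(r, ε)`-Gromov–Hausdorff approximation** `f : (X, p) → (Y, q)`: `f p = q`, the
distortion of `f` on the closed ball `B̄(p, r)` is at most `ε`, and every point of `B̄(q, r - 2ε)`
lies within `ε` of `f(B̄(p, r))`. This is the map part of the pointed `ε`-approximations of
Huang–Huang–Wang–Zhu 2026 §2.1 (p. 6) with radius and error decoupled (`r ↔ 1/ε`), cf.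
`IsPointedEpsGHApprox.isPointedGHApprox`; the density radius `r - 2ε` makes approximations
restrict to smaller balls (`IsPointedGHApprox.mono`).
[cite: HuangHuangWangZhu2026, §2.1 p. 6] -/
def IsPointedGHApprox (r ε : ℝ) (p : X) (q : Y) (f : X → Y) : Prop :=
  f p = q ∧
  (∀ x₁ ∈ closedBall p r, ∀ x₂ ∈ closedBall p r, |dist (f x₁) (f x₂) - dist x₁ x₂| ≤ ε) ∧
  (∀ y ∈ closedBall q (r - 2 * ε), ∃ x ∈ closedBall p r, dist (f x) y ≤ ε)

variable {r r' ε ε' δ : ℝ} {p : X} {q : Y} {o : Z} {f : X → Y} {g : Y → Z}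

/-- Unfolding lemma. [folklore] -/
theorem isPointedGHApprox_iff : IsPointedGHApprox r ε p q f ↔
    f p = q ∧
    (∀ x₁ ∈ closedBall p r, ∀ x₂ ∈ closedBall p r, |dist (f x₁) (f x₂) - dist x₁ x₂| ≤ ε) ∧
    (∀ y ∈ closedBall q (r - 2 * ε), ∃ x ∈ closedBall p r, dist (f x) y ≤ ε) :=
  Iff.rfl

namespace IsPointedGHApprox

/-- Base points correspond. [folklore] -/
theorem map_pt (h : IsPointedGHApprox r ε p q f) : f p = q := h.1

/-- The distortion bound. [folklore] -/
theorem abs_sub_le (h : IsPointedGHApprox r ε p q f) {x₁ x₂ : X} (h₁ : x₁ ∈ closedBall p r)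
    (h₂ : x₂ ∈ closedBall p r) : |dist (f x₁) (f x₂) - dist x₁ x₂| ≤ ε :=
  h.2.1 x₁ h₁ x₂ h₂

/-- `d(f x₁, f x₂) ≤ d(x₁, x₂) + ε` on the ball. [folklore] -/
theorem dist_le (h : IsPointedGHApprox r ε p q f) {x₁ x₂ : X} (h₁ : x₁ ∈ closedBall p r)
    (h₂ : x₂ ∈ closedBall p r) : dist (f x₁) (f x₂) ≤ dist x₁ x₂ + ε := by
  have := (abs_le.mp (h.abs_sub_le h₁ h₂)).2; linarith

/-- `d(x₁, x₂) ≤ d(f x₁, f x₂) + ε` on the ball. [folklore] -/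
theorem le_dist_add (h : IsPointedGHApprox r ε p q f) {x₁ x₂ : X} (h₁ : x₁ ∈ closedBall p r)
    (h₂ : x₂ ∈ closedBall p r) : dist x₁ x₂ ≤ dist (f x₁) (f x₂) + ε := by
  have := (abs_le.mp (h.abs_sub_le h₁ h₂)).1; linarith

/-- The density condition. [folklore] -/
theorem exists_dist_le (h : IsPointedGHApprox r ε p q f) {y : Y}
    (hy : y ∈ closedBall q (r - 2 * ε)) : ∃ x ∈ closedBall p r, dist (f x) y ≤ ε :=
  h.2.2 y hy

/-- A point of `B̄(p, r)` forces `0 ≤ r`. [folklore] -/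
theorem radius_nonneg {x : X} (hx : x ∈ closedBall p r) : 0 ≤ r :=
  dist_nonneg.trans (mem_closedBall.mp hx)

/-- The error is nonnegative as soon as the ball is nonempty. [folklore] -/
theorem nonneg (h : IsPointedGHApprox r ε p q f) (hr : 0 ≤ r) : 0 ≤ ε := by
  have := h.abs_sub_le (mem_closedBall_self hr) (mem_closedBall_self hr)
  exact (abs_nonneg _).trans this

/-- `d(f x, q) ≤ d(x, p) + ε` on the ball. [folklore] -/
theorem dist_map_pt_le (h : IsPointedGHApprox r ε p q f) {x : X} (hx : x ∈ closedBall p r) :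
    dist (f x) q ≤ dist x p + ε := by
  rw [← h.map_pt]
  exact h.dist_le hx (mem_closedBall_self (radius_nonneg hx))

/-- `d(x, p) ≤ d(f x, q) + ε` on the ball. [folklore] -/
theorem le_dist_map_pt_add (h : IsPointedGHApprox r ε p q f) {x : X} (hx : x ∈ closedBall p r) :
    dist x p ≤ dist (f x) q + ε := by
  rw [← h.map_pt]
  exact h.le_dist_add hx (mem_closedBall_self (radius_nonneg hx))

/-- `f` maps `B̄(p, r)` into `B̄(q, r + ε)` (printed: "`f : B_{1/ε}(p) → B_{1/ε+ε}(q)`").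
[cite: HuangHuangWangZhu2026, §2.1 p. 6] -/
theorem mapsTo (h : IsPointedGHApprox r ε p q f) :
    MapsTo f (closedBall p r) (closedBall q (r + ε)) := fun x hx ↦
  mem_closedBall.mpr ((h.dist_map_pt_le hx).trans (by linarith [mem_closedBall.mp hx]))

/-- **Restriction / weakening**: an `(r, ε)`-approximation is an `(r', ε')`-approximation for
`r' ≤ r`, `ε ≤ ε'` (the density witnesses stay in the smaller ball thanks to the radius
`r' - 2ε'`). [folklore] -/
theorem mono (h : IsPointedGHApprox r ε p q f) (hr : r' ≤ r) (hε : ε ≤ ε') :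
    IsPointedGHApprox r' ε' p q f := by
  refine ⟨h.map_pt, fun x₁ h₁ x₂ h₂ ↦ ?_, fun y hy ↦ ?_⟩
  · exact (h.abs_sub_le (closedBall_subset_closedBall hr h₁)
      (closedBall_subset_closedBall hr h₂)).trans hε
  · have hy' : y ∈ closedBall q (r - 2 * ε) :=
      closedBall_subset_closedBall (by linarith) hy
    obtain ⟨x, hx, hxy⟩ := h.exists_dist_le hy'
    refine ⟨x, mem_closedBall.mpr ?_, hxy.trans hε⟩
    have h1 := h.le_dist_map_pt_add hx
    have h2 : dist (f x) q ≤ dist (f x) y + dist y q := dist_triangle _ _ _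
    have h3 := mem_closedBall.mp hy
    linarith

/-- **Composition**: an `(r, ε)`-approximation followed by an `(r + ε, δ)`-approximation is an
`(r, ε + 2δ)`-approximation. [folklore] -/
theorem comp (hg : IsPointedGHApprox (r + ε) δ q o g) (hf : IsPointedGHApprox r ε p q f)
    (hε : 0 ≤ ε) (hδ : 0 ≤ δ) : IsPointedGHApprox r (ε + 2 * δ) p o (g ∘ f) := by
  refine ⟨by simp [hf.map_pt, hg.map_pt], fun x₁ h₁ x₂ h₂ ↦ ?_, fun z hz ↦ ?_⟩
  · have hg' := hg.abs_sub_le (hf.mapsTo h₁) (hf.mapsTo h₂)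
    have hf' := hf.abs_sub_le h₁ h₂
    rw [abs_le] at hg' hf' ⊢
    simp only [comp_apply]
    constructor <;> linarith [hg'.1, hg'.2, hf'.1, hf'.2]
  · have hz' : z ∈ closedBall o (r + ε - 2 * δ) :=
      closedBall_subset_closedBall (by linarith) hz
    obtain ⟨y, hy, hyz⟩ := hg.exists_dist_le hz'
    have hyq : y ∈ closedBall q (r - 2 * ε) := by
      rw [mem_closedBall]
      have h1 := hg.le_dist_map_pt_add hy
      have h2 : dist (g y) o ≤ dist (g y) z + dist z o := dist_triangle _ _ _
      have h3 := mem_closedBall.mp hz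
      linarith
    obtain ⟨x, hx, hxy⟩ := hf.exists_dist_le hyq
    refine ⟨x, hx, ?_⟩
    have h4 := hg.dist_le (hf.mapsTo hx) hy
    calc dist (g (f x)) z ≤ dist (g (f x)) (g y) + dist (g y) z := dist_triangle _ _ _
      _ ≤ ε + 2 * δ := by linarith

/-- `|d(a, b) - d(a', b')| ≤ d(a, a') + d(b, b')`. [folklore] -/
theorem _root_.Literature.Geometry.MetricGeometry.abs_dist_sub_dist_le {W : Type*}
    [PseudoMetricSpace W] (a b a' b' : W) :
    |dist a b - dist a' b'| ≤ dist a a' + dist b b' := by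
  have h1 : |dist a b - dist a' b| ≤ dist a a' := abs_dist_sub_le a a' b
  have h2 : |dist a' b - dist a' b'| ≤ dist b b' := by
    have := abs_dist_sub_le b b' a'
    rwa [dist_comm b a', dist_comm b' a'] at this
  calc |dist a b - dist a' b'| = |(dist a b - dist a' b) + (dist a' b - dist a' b')| := by ring_nf
    _ ≤ |dist a b - dist a' b| + |dist a' b - dist a' b'| := abs_add_le _ _
    _ ≤ dist a a' + dist b b' := add_le_add h1 h2

/-- **Quasi-inverse**: an `(r, ε)`-approximation `f : (X, p) → (Y, q)` has an
`(r - 2ε, 3ε)`-approximation `g : (Y, q) → (X, p)` with `f ∘ g` within `ε` of the identity on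
`B̄(q, r - 2ε)` and `g ∘ f` within `2ε` of the identity on `B̄(p, r - 3ε)`. [folklore] -/
theorem exists_quasiInverse (hf : IsPointedGHApprox r ε p q f) (hε : 0 ≤ ε) :
    ∃ g : Y → X, IsPointedGHApprox (r - 2 * ε) (3 * ε) q p g ∧
      (∀ y ∈ closedBall q (r - 2 * ε), g y ∈ closedBall p r ∧ dist (f (g y)) y ≤ ε) ∧
      (∀ x ∈ closedBall p (r - 3 * ε), dist (g (f x)) x ≤ 2 * ε) := by
  classical
  -- the quasi-inverse: `q ↦ p`, a density witness on `B̄(q, r - 2ε)`, `p` elsewhere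
  set g : Y → X := fun y ↦ if y = q then p else
    if hy : y ∈ closedBall q (r - 2 * ε) then (hf.exists_dist_le hy).choose else p with hg_def
  have hg : ∀ y ∈ closedBall q (r - 2 * ε), g y ∈ closedBall p r ∧ dist (f (g y)) y ≤ ε := by
    intro y hy
    by_cases hyq : y = q
    · subst hyq
      have hr : 0 ≤ r := by have := radius_nonneg hy; linarith
      simp only [hg_def, if_true]
      exact ⟨mem_closedBall_self hr, by rw [hf.map_pt, dist_self]; exact hε⟩
    · simp only [hg_def, hyq, if_false, hy, dif_pos]
      exact (hf.exists_dist_le hy).choose_spec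
  have hgf : ∀ x ∈ closedBall p r, f x ∈ closedBall q (r - 2 * ε) →
      dist (g (f x)) x ≤ 2 * ε := by
    intro x hx hfx
    have h1 := hf.le_dist_add (hg (f x) hfx).1 hx
    have h2 := (hg (f x) hfx).2
    linarith
  refine ⟨g, ⟨by simp [hg_def], fun y₁ h₁ y₂ h₂ ↦ ?_, fun x hx ↦ ?_⟩, hg, fun x hx ↦ ?_⟩
  · -- distortion of `g`
    have hd := hf.abs_sub_le (hg y₁ h₁).1 (hg y₂ h₂).1
    have he := abs_dist_sub_dist_le (f (g y₁)) (f (g y₂)) y₁ y₂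
    have h1 := (hg y₁ h₁).2
    have h2 := (hg y₂ h₂).2
    rw [abs_le] at hd he ⊢
    constructor <;> linarith [hd.1, hd.2, he.1, he.2]
  · -- density of `g`: `x` is within `2ε` of `g (f x)`
    have hxr : x ∈ closedBall p r := closedBall_subset_closedBall (by linarith) hx
    have hfx : f x ∈ closedBall q (r - 2 * ε) := by
      rw [mem_closedBall]
      have := hf.dist_map_pt_le hxr
      have := mem_closedBall.mp hx
      linarith
    exact ⟨f x, hfx, (hgf x hxr hfx).trans (by linarith)⟩
  · have hxr : x ∈ closedBall p r := closedBall_subset_closedBall (by linarith) hx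
    have hfx : f x ∈ closedBall q (r - 2 * ε) := by
      rw [mem_closedBall]
      have := hf.dist_map_pt_le hxr
      have := mem_closedBall.mp hx
      linarith
    exact hgf x hxr hfx

end IsPointedGHApprox

/-- The identity is an `(r, ε)`-approximation for every `ε ≥ 0`. [folklore] -/
theorem isPointedGHApprox_id (hε : 0 ≤ ε) (r : ℝ) (p : X) : IsPointedGHApprox r ε p p id :=
  ⟨rfl, fun x₁ _ x₂ _ ↦ by simpa using hε,
    fun y hy ↦ ⟨y, closedBall_subset_closedBall (by linarith) hy, by simpa using hε⟩⟩

/-- An isometric equivalence is an `(r, ε)`-approximation between corresponding base points,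
for every `ε ≥ 0`. [folklore] -/
theorem _root_.IsometryEquiv.isPointedGHApprox (e : X ≃ᵢ Y) (hε : 0 ≤ ε) (r : ℝ) (p : X) :
    IsPointedGHApprox r ε p (e p) e := by
  refine ⟨rfl, fun x₁ _ x₂ _ ↦ by simpa [e.dist_eq] using hε, fun y hy ↦ ?_⟩
  refine ⟨e.symm y, mem_closedBall.mpr ?_, by simpa using hε⟩
  have : dist (e.symm y) p = dist y (e p) := by
    rw [← e.dist_eq (e.symm y) p, e.apply_symm_apply]
  rw [this]
  have := mem_closedBall.mp hy
  linarith

end Approx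

/-! ### §2. The printed one-parameter form -/

section Printed

variable {X Y : Type*} [PseudoMetricSpace X] [PseudoMetricSpace Y]
  {ε r : ℝ} {p : X} {q : Y} {f : X → Y}

/-- **The printed pointed `ε`-Gromov–Hausdorff approximation (map part), verbatim**
(Huang–Huang–Wang–Zhu 2026, §2.1 p. 6): "`f : B_{1/ε}(p) → B_{1/ε+ε}(q)` … `f(p) = q`,
`f(B_{1/ε}(p))` is `2ε`-dense in `B_{1/ε+ε}(q)` and `|d(f(x₁), f(x₂)) - d(x₁, x₂)| ≤ ε` for all
`x₁, x₂ ∈ B_{1/ε}(p)`". (`f` is taken as a map on all of `X`; that it sends `B_{1/ε}(p)` into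
`B_{1/ε+ε}(q)` is automatic, `IsPointedEpsGHApprox.mapsTo`. The two conditions on the groups of a
pointed `ε`-eGHA are not part of this definition.) [cite: HuangHuangWangZhu2026, §2.1 p. 6] -/
def IsPointedEpsGHApprox (ε : ℝ) (p : X) (q : Y) (f : X → Y) : Prop :=
  f p = q ∧
  (∀ x₁ ∈ ball p (1 / ε), ∀ x₂ ∈ ball p (1 / ε), |dist (f x₁) (f x₂) - dist x₁ x₂| ≤ ε) ∧
  (∀ y ∈ ball q (1 / ε + ε), ∃ x ∈ ball p (1 / ε), dist (f x) y ≤ 2 * ε)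

/-- Unfolding lemma. [cite: HuangHuangWangZhu2026, §2.1 p. 6] -/
theorem isPointedEpsGHApprox_iff : IsPointedEpsGHApprox ε p q f ↔
    f p = q ∧
    (∀ x₁ ∈ ball p (1 / ε), ∀ x₂ ∈ ball p (1 / ε), |dist (f x₁) (f x₂) - dist x₁ x₂| ≤ ε) ∧
    (∀ y ∈ ball q (1 / ε + ε), ∃ x ∈ ball p (1 / ε), dist (f x) y ≤ 2 * ε) :=
  Iff.rfl

/-- The printed codomain: `f` maps `B_{1/ε}(p)` into `B_{1/ε+ε}(q)`.
[cite: HuangHuangWangZhu2026, §2.1 p. 6] -/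
theorem IsPointedEpsGHApprox.mapsTo (h : IsPointedEpsGHApprox ε p q f) (hε : 0 < ε) :
    MapsTo f (ball p (1 / ε)) (ball q (1 / ε + ε)) := by
  intro x hx
  have hp : p ∈ ball p (1 / ε) := mem_ball_self (by positivity)
  have hd := (abs_le.mp (h.2.1 x hx p hp)).2
  rw [h.1] at hd
  rw [mem_ball] at hx ⊢
  linarith

/-- **Printed ⇒ two-parameter**: a printed `ε`-approximation is an `(r, 2ε)`-approximation for
every radius `r < 1/ε`. [cite: HuangHuangWangZhu2026, §2.1 p. 6] -/
theorem IsPointedEpsGHApprox.isPointedGHApprox (h : IsPointedEpsGHApprox ε p q f) (hε : 0 < ε)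
    (hr : r < 1 / ε) : IsPointedGHApprox r (2 * ε) p q f := by
  have hsub : closedBall p r ⊆ ball p (1 / ε) := closedBall_subset_ball hr
  refine ⟨h.1, fun x₁ h₁ x₂ h₂ ↦ (h.2.1 x₁ (hsub h₁) x₂ (hsub h₂)).trans (by linarith),
    fun y hy ↦ ?_⟩
  have hy' : y ∈ ball q (1 / ε + ε) := by
    rw [mem_closedBall] at hy; rw [mem_ball]; linarith
  obtain ⟨x, hx, hxy⟩ := h.2.2 y hy'
  refine ⟨x, mem_closedBall.mpr ?_, hxy⟩
  have hp : p ∈ ball p (1 / ε) := mem_ball_self (by positivity)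
  have hd := (abs_le.mp (h.2.1 x hx p hp)).1
  rw [h.1] at hd
  have h2 : dist (f x) q ≤ dist (f x) y + dist y q := dist_triangle _ _ _
  have h3 := mem_closedBall.mp hy
  linarith

end Printed

/-! ### §3. Pointed Gromov–Hausdorff convergence of a sequence of pointed spaces -/

section Conv

variable {X : ℕ → Type*} [∀ i, PseudoMetricSpace (X i)] {Y Y' : Type*} [PseudoMetricSpace Y]
  [PseudoMetricSpace Y'] {p : ∀ i, X i} {q : Y} {q' : Y'}

/-- **Pointed Gromov–Hausdorff convergence** `(Xᵢ, pᵢ) → (Y, q)`: for every radius `r` and every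
`ε > 0`, for all large `i` there is a pointed `(r, ε)`-approximation `(Xᵢ, pᵢ) → (Y, q)`. This is
implied by the printed "`d_GH((Xᵢ, pᵢ), (Y, q)) → 0`, i.e. printed `εᵢ`-approximations exist with
`εᵢ → 0`" (`PointedGHConv.of_isPointedEpsGHApprox`) and equivalent to it on length spaces.
[cite: HuangHuangWangZhu2026, §2.1 p. 6] -/
def PointedGHConv (p : ∀ i, X i) (q : Y) : Prop :=
  ∀ r ε : ℝ, 0 < ε → ∀ᶠ i in atTop, ∃ f : X i → Y, IsPointedGHApprox r ε (p i) q f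

/-- Unfolding lemma. [folklore] -/
theorem pointedGHConv_iff : PointedGHConv p q ↔
    ∀ r ε : ℝ, 0 < ε → ∀ᶠ i in atTop, ∃ f : X i → Y, IsPointedGHApprox r ε (p i) q f :=
  Iff.rfl

/-- **Printed convergence implies convergence**: if printed `ε`-approximations
`(Xᵢ, pᵢ) → (Y, q)` eventually exist for every `ε > 0`, then `(Xᵢ, pᵢ) → (Y, q)`.
[cite: HuangHuangWangZhu2026, §2.1 p. 6] -/
theorem PointedGHConv.of_isPointedEpsGHApprox
    (h : ∀ ε : ℝ, 0 < ε → ∀ᶠ i in atTop, ∃ f : X i → Y, IsPointedEpsGHApprox ε (p i) q f) :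
    PointedGHConv p q := by
  intro r ε hε
  -- a printed scale `η` with `2η ≤ ε` and `r < 1/η`
  obtain ⟨η, hη, hηε, hηr⟩ : ∃ η : ℝ, 0 < η ∧ 2 * η ≤ ε ∧ r < 1 / η := by
    refine ⟨min (ε / 2) (1 / (|r| + 1)), by positivity, ?_, ?_⟩
    · linarith [min_le_left (ε / 2) (1 / (|r| + 1))]
    · have h1 : min (ε / 2) (1 / (|r| + 1)) ≤ 1 / (|r| + 1) := min_le_right _ _
      have h2 : 0 < min (ε / 2) (1 / (|r| + 1)) := by positivity
      calc r ≤ |r| := le_abs_self r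
        _ < |r| + 1 := lt_add_one _
        _ = 1 / (1 / (|r| + 1)) := by rw [one_div_one_div]
        _ ≤ 1 / min (ε / 2) (1 / (|r| + 1)) := by
          apply one_div_le_one_div_of_le h2 h1
  filter_upwards [h η hη] with i ⟨f, hf⟩
  exact ⟨f, (hf.isPointedGHApprox hη hηr).mono le_rfl hηε⟩

/-- A constant sequence converges to itself. [folklore] -/
theorem pointedGHConv_const {W : Type*} [PseudoMetricSpace W] (w : W) :
    PointedGHConv (X := fun _ ↦ W) (fun _ ↦ w) w :=
  fun r _ hε ↦ Eventually.of_forall fun _ ↦ ⟨id, isPointedGHApprox_id hε.le r w⟩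

/-- More generally, a sequence of spaces pointedly isometric to `(Y, q)` converges to `(Y, q)`.
[folklore] -/
theorem pointedGHConv_of_isometryEquiv (e : ∀ i, X i ≃ᵢ Y) (he : ∀ i, e i (p i) = q) :
    PointedGHConv p q :=
  fun r _ hε ↦ Eventually.of_forall fun i ↦ ⟨e i, he i ▸ (e i).isPointedGHApprox hε.le r (p i)⟩

/-- Subsequences of a convergent sequence converge. [folklore] -/
theorem PointedGHConv.subseq (h : PointedGHConv p q) {φ : ℕ → ℕ} (hφ : StrictMono φ) :
    PointedGHConv (X := fun k ↦ X (φ k)) (fun k ↦ p (φ k)) q :=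
  fun r ε hε ↦ hφ.tendsto_atTop.eventually (h r ε hε)

/-- **Approximations in the opposite direction**: if `(Xᵢ, pᵢ) → (Y, q)` then for all large `i`
there are `(r, ε)`-approximations `(Y, q) → (Xᵢ, pᵢ)` (quasi-inverses). [folklore] -/
theorem PointedGHConv.eventually_exists_inverse (h : PointedGHConv p q) (r : ℝ) {ε : ℝ}
    (hε : 0 < ε) : ∀ᶠ i in atTop, ∃ g : Y → X i, IsPointedGHApprox r ε q (p i) g := by
  filter_upwards [h (r + 2 * (ε / 3)) (ε / 3) (by positivity)] with i ⟨f, hf⟩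
  obtain ⟨g, hg, -, -⟩ := hf.exists_quasiInverse (by positivity)
  exact ⟨g, by convert hg using 1 <;> ring⟩

/-- **Sequential form**: if `(Xᵢ, pᵢ) → (Y, q)` there are approximations `fᵢ : (Xᵢ, pᵢ) → (Y, q)`
with parameters `(rᵢ, εᵢ)`, `rᵢ → ∞`, `εᵢ → 0` (a diagonal choice by `Nat.findGreatest`).
[folklore] -/
theorem PointedGHConv.exists_seq (h : PointedGHConv p q) :
    ∃ (ρ e : ℕ → ℝ) (f : ∀ i, X i → Y), Tendsto ρ atTop atTop ∧ Tendsto e atTop (𝓝 0) ∧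
      ∀ i, 0 < e i ∧ IsPointedGHApprox (ρ i) (e i) (p i) q (f i) := by
  classical
  -- `P i n`: an `(n, 1/(n+1))`-approximation `(Xᵢ, pᵢ) → (Y, q)` exists
  let P : ℕ → ℕ → Prop := fun i n ↦ ∃ f : X i → Y, IsPointedGHApprox n (1 / (n + 1)) (p i) q f
  have hP : ∀ n, ∀ᶠ i in atTop, P i n := fun n ↦ h n (1 / (n + 1)) (by positivity)
  -- `N i`: the largest `n ≤ i` with `P i n` (or `0`)
  let N : ℕ → ℕ := fun i ↦ Nat.findGreatest (P i) i
  have hN : Tendsto N atTop atTop := by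
    rw [Filter.tendsto_atTop]
    intro n
    obtain ⟨i₀, hi₀⟩ := eventually_atTop.mp (hP n)
    refine eventually_atTop.mpr ⟨max i₀ n, fun i hi ↦ ?_⟩
    exact Nat.le_findGreatest ((le_max_right _ _).trans hi) (hi₀ i ((le_max_left _ _).trans hi))
  -- when `P i (N i)` holds use its approximation, else a vacuous one of radius `-1`
  have hchoice : ∀ i, ∃ (ρe : ℝ × ℝ) (f : X i → Y), 0 < ρe.2 ∧ ρe.2 ≤ 1 / (N i + 1) ∧
      (P i (N i) → ρe.1 = N i) ∧ IsPointedGHApprox ρe.1 ρe.2 (p i) q f := by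
    intro i
    by_cases hi : P i (N i)
    · obtain ⟨f, hf⟩ := hi
      exact ⟨(N i, 1 / (N i + 1)), f, by positivity, le_rfl, fun _ ↦ rfl, hf⟩
    · refine ⟨(-1, 1 / (N i + 1)), fun _ ↦ q, by positivity, le_rfl, fun h' ↦ (hi h').elim,
        rfl, fun x₁ h₁ ↦ ?_, fun y hy ↦ ?_⟩
      · have := IsPointedGHApprox.radius_nonneg (p := p i) h₁; norm_num at this
      · have h0 := IsPointedGHApprox.radius_nonneg (p := q) hy
        have : (0 : ℝ) < 1 / (N i + 1) := by positivity
        linarith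
  choose ρe f h0 hle hρ hf using hchoice
  refine ⟨fun i ↦ (ρe i).1, fun i ↦ (ρe i).2, f, ?_, ?_, fun i ↦ ⟨h0 i, hf i⟩⟩
  · -- `ρ i = N i` eventually, and `N i → ∞`
    have hev : ∀ᶠ i in atTop, (ρe i).1 = N i := by
      have h1 : ∀ᶠ i in atTop, 1 ≤ N i := hN.eventually (eventually_ge_atTop 1)
      filter_upwards [h1] with i hi
      -- `N i = findGreatest (P i) i ≥ 1` forces `P i (N i)`
      exact hρ i (Nat.findGreatest_of_ne_zero rfl (by omega))
    rw [tendsto_congr' hev]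
    exact tendsto_natCast_atTop_atTop.comp hN
  · -- `0 < e i ≤ 1/(N i + 1) → 0`
    have hlim : Tendsto (fun i ↦ (1 : ℝ) / (N i + 1)) atTop (𝓝 0) := by
      have h1 : Tendsto (fun n : ℕ ↦ (1 : ℝ) / ((n : ℝ) + 1)) atTop (𝓝 0) :=
        tendsto_one_div_add_atTop_nhds_zero_nat
      exact h1.comp hN
    exact squeeze_zero (fun i ↦ (h0 i).le) hle hlim

/-- Conversely, approximations with `rᵢ → ∞` and `εᵢ → 0` give convergence. [folklore] -/
theorem pointedGHConv_of_seq {ρ e : ℕ → ℝ} {f : ∀ i, X i → Y} (hρ : Tendsto ρ atTop atTop)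
    (he : Tendsto e atTop (𝓝 0)) (hf : ∀ᶠ i in atTop, IsPointedGHApprox (ρ i) (e i) (p i) q (f i)) :
    PointedGHConv p q := by
  intro r ε hε
  filter_upwards [hf, hρ.eventually (eventually_ge_atTop r),
    (tendsto_order.mp he).2 ε hε] with i hi hri hei
  exact ⟨f i, hi.mono hri hei.le⟩

/-- **Two limits of one sequence are arbitrarily well approximable by each other**: if
`(Xᵢ, pᵢ) → (Y, q)` and `(Xᵢ, pᵢ) → (Y', q')` then for every `r` and `ε > 0` there is an
`(r, ε)`-approximation `(Y, q) → (Y', q')` (a quasi-inverse into `Xᵢ` followed by the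
approximation to `Y'`, `i` large). [folklore] -/
theorem PointedGHConv.exists_isPointedGHApprox_of_pointedGHConv (h : PointedGHConv p q)
    (h' : PointedGHConv p q') (r : ℝ) {ε : ℝ} (hε : 0 < ε) :
    ∃ g : Y → Y', IsPointedGHApprox r ε q q' g := by
  -- scale `η = ε/5`: quasi-inverse `(r, 3η)` then `(r + 3η, η)` gives `(r, 5η)`
  set η : ℝ := ε / 5 with hη_def
  have hη : 0 < η := by positivity
  obtain ⟨i, ⟨gi, hgi⟩, ⟨fi, hfi⟩⟩ :=
    ((h.eventually_exists_inverse r (by positivity : 0 < 3 * η)).and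
      (h' (r + 3 * η) η hη)).exists
  refine ⟨fi ∘ gi, ?_⟩
  have := hfi.comp hgi (by positivity) hη.le
  convert this using 1
  rw [hη_def]; ring

end Conv

/-! ### §4. Uniqueness of proper pointed limits -/

section Unique

variable {Y Y' : Type*} [MetricSpace Y] [MetricSpace Y'] {q : Y} {q' : Y'}

/-- Along an ultrafilter, a sequence eventually inside a compact set converges to a point of it.
[folklore] -/
theorem exists_tendsto_of_eventually_mem {W : Type*} [TopologicalSpace W] (𝒰 : Ultrafilter ℕ)
    {K : Set W} (hK : IsCompact K) {u : ℕ → W} (hu : ∀ᶠ n in (𝒰 : Filter ℕ), u n ∈ K) :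
    ∃ w ∈ K, Tendsto u (𝒰 : Filter ℕ) (𝓝 w) := by
  have hle : (𝒰.map u : Filter W) ≤ 𝓟 K := by
    rw [le_principal_iff, Ultrafilter.mem_coe, Ultrafilter.mem_map]
    exact hu
  obtain ⟨w, hw, hw'⟩ := hK.ultrafilter_le_nhds (𝒰.map u) hle
  exact ⟨w, hw, hw'⟩

/-- **An isometric self-map of a proper metric space with a fixed point is onto**: it maps each
compact ball `B̄(q, R)` isometrically into itself, hence onto itself
(`Isometry.surjective_of_compactSpace`). (Without a fixed point this fails: `n ↦ n + 1` on `ℕ`.)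
[folklore] -/
theorem _root_.Isometry.surjective_of_properSpace [ProperSpace Y] {e : Y → Y} (he : Isometry e)
    (hq : e q = q) : Surjective e := by
  intro y
  set R := dist y q
  have hmaps : MapsTo e (closedBall q R) (closedBall q R) := by
    intro z hz
    rw [mem_closedBall] at hz ⊢
    rwa [← hq, he.dist_eq]
  haveI : CompactSpace (closedBall q R) :=
    isCompact_iff_compactSpace.mp (isCompact_closedBall q R)
  have hiso : Isometry (hmaps.restrict e (closedBall q R) (closedBall q R)) := by
    refine Isometry.of_dist_eq fun a b ↦ ?_
    rw [Subtype.dist_eq, Subtype.dist_eq]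
    exact he.dist_eq a b
  obtain ⟨⟨z, hz⟩, hzy⟩ := hiso.surjective_of_compactSpace ⟨y, mem_closedBall.mpr le_rfl⟩
  exact ⟨z, congrArg Subtype.val hzy⟩

/-- **Arbitrarily good pointed approximations into a proper space yield a pointed isometric
embedding**: if for every `n` there is an `(n, 1/(n+1))`-approximation `(Y, q) → (Y', q')` with
`Y'` proper, then there is an isometry `ι : Y → Y'` with `ι q = q'` (an ultralimit of the
approximations: for each `y` the values `hₙ y` eventually lie in the compact ball
`B̄(q', d(y, q) + 1)`). [folklore] -/
theorem exists_isometry_of_forall_isPointedGHApprox [ProperSpace Y']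
    (h : ∀ n : ℕ, ∃ g : Y → Y', IsPointedGHApprox n (1 / (n + 1)) q q' g) :
    ∃ ι : Y → Y', Isometry ι ∧ ι q = q' := by
  choose g hg using h
  haveI : Nonempty Y' := ⟨q'⟩
  set 𝒰 : Ultrafilter ℕ := hyperfilter ℕ
  have h𝒰 : (𝒰 : Filter ℕ) ≤ atTop := by
    rw [← Nat.cofinite_eq_atTop]; exact hyperfilter_le_cofinite
  -- every `y` is eventually in the ball of radius `n` and is moved into a fixed compact ball
  have hball : ∀ y : Y, ∀ᶠ n : ℕ in atTop, y ∈ closedBall q (n : ℝ) := fun y ↦ by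
    filter_upwards [eventually_ge_atTop ⌈dist y q⌉₊] with n hn
    exact mem_closedBall.mpr ((Nat.le_ceil _).trans (by exact_mod_cast hn))
  have hsmall : ∀ n : ℕ, (1 : ℝ) / (n + 1) ≤ 1 := fun n ↦ by
    rw [div_le_one (by positivity)]; linarith [n.cast_nonneg (α := ℝ)]
  have hmem : ∀ y : Y, ∀ᶠ n in (𝒰 : Filter ℕ), g n y ∈ closedBall q' (dist y q + 1) := by
    intro y
    filter_upwards [h𝒰 (hball y)] with n hn
    exact mem_closedBall.mpr (((hg n).dist_map_pt_le hn).trans (by linarith [hsmall n]))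
  -- the ultralimit
  set ι : Y → Y' := fun y ↦ limUnder (𝒰 : Filter ℕ) fun n ↦ g n y
  have hι : ∀ y, Tendsto (fun n ↦ g n y) (𝒰 : Filter ℕ) (𝓝 (ι y)) := fun y ↦ by
    obtain ⟨w, -, hw⟩ := exists_tendsto_of_eventually_mem 𝒰 (isCompact_closedBall _ _) (hmem y)
    exact tendsto_nhds_limUnder ⟨w, hw⟩
  refine ⟨ι, Isometry.of_dist_eq fun y₁ y₂ ↦ ?_, ?_⟩
  · -- distances pass to the limit, distortion `≤ 1/(n+1) → 0`
    have hd : Tendsto (fun n ↦ dist (g n y₁) (g n y₂)) (𝒰 : Filter ℕ)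
        (𝓝 (dist (ι y₁) (ι y₂))) := (hι y₁).dist (hι y₂)
    have hd' : Tendsto (fun n ↦ dist (g n y₁) (g n y₂)) (𝒰 : Filter ℕ) (𝓝 (dist y₁ y₂)) := by
      rw [Metric.tendsto_nhds]
      intro δ hδ
      have h0 : ∀ᶠ n : ℕ in (𝒰 : Filter ℕ), (1 : ℝ) / (n + 1) < δ :=
        h𝒰 ((tendsto_order.mp tendsto_one_div_add_atTop_nhds_zero_nat).2 δ hδ)
      filter_upwards [h0, h𝒰 (hball y₁), h𝒰 (hball y₂)] with n hn h₁ h₂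
      rw [Real.dist_eq]
      exact ((hg n).abs_sub_le h₁ h₂).trans_lt hn
    exact tendsto_nhds_unique hd hd'
  · -- `g n q = q'` for all `n`
    have : Tendsto (fun n ↦ g n q) (𝒰 : Filter ℕ) (𝓝 q') := by
      simp_rw [(hg _).map_pt]; exact tendsto_const_nhds
    exact tendsto_nhds_unique (hι q) this

/-- **Approximations in both directions give a pointed isometry**: if `(Y, q)` and `(Y', q')` are
proper and admit `(n, 1/(n+1))`-approximations in both directions for every `n`, they are
pointedly isometric: the two isometric embeddings of
`exists_isometry_of_forall_isPointedGHApprox` compose to isometric self-maps with a fixed point,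
which are onto (`Isometry.surjective_of_properSpace`). [folklore] -/
theorem exists_isometryEquiv_of_forall_isPointedGHApprox [ProperSpace Y] [ProperSpace Y']
    (h : ∀ n : ℕ, ∃ g : Y → Y', IsPointedGHApprox n (1 / (n + 1)) q q' g)
    (h' : ∀ n : ℕ, ∃ g : Y' → Y, IsPointedGHApprox n (1 / (n + 1)) q' q g) :
    ∃ e : Y ≃ᵢ Y', e q = q' := by
  obtain ⟨ι, hι, hιq⟩ := exists_isometry_of_forall_isPointedGHApprox h
  obtain ⟨κ, hκ, hκq⟩ := exists_isometry_of_forall_isPointedGHApprox h'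
  have hsurj : Surjective ι := by
    have hfix : (ι ∘ κ) q' = q' := by simp [hκq, hιq]
    exact ((hι.comp hκ).surjective_of_properSpace hfix).of_comp
  exact ⟨IsometryEquiv.mk (Equiv.ofBijective ι ⟨hι.injective, hsurj⟩) hι, hιq⟩

/-- **Uniqueness of proper pointed Gromov–Hausdorff limits**: two proper pointed limits of one
sequence of pointed pseudometric spaces are pointedly isometric (Burago–Burago–Ivanov, Ch. 8
§8.1; Petrunin, Lecture 6: a proper pointed limit is the pointed ultralimit). [folklore] -/
theorem PointedGHConv.exists_isometryEquiv {X : ℕ → Type*} [∀ i, PseudoMetricSpace (X i)]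
    {p : ∀ i, X i} [ProperSpace Y] [ProperSpace Y'] (h : PointedGHConv p q)
    (h' : PointedGHConv p q') : ∃ e : Y ≃ᵢ Y', e q = q' :=
  exists_isometryEquiv_of_forall_isPointedGHApprox
    (fun n ↦ h.exists_isPointedGHApprox_of_pointedGHConv h' n (by positivity))
    (fun n ↦ h'.exists_isPointedGHApprox_of_pointedGHConv h n (by positivity))

end Unique

/-! ### §5. Bounded spaces: bridge with absolute approximations -/

section Bridge

variable {X Y : Type*} [PseudoMetricSpace X] [PseudoMetricSpace Y] {ε r : ℝ} {p : X} {q : Y}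
  {f : X → Y}

/-- **Absolute ⇒ pointed** on a ball containing the whole space, after moving the base point:
an `ε`-GH approximation `f` with `d(f p, q) = δ` becomes, once redefined at `p` by `f p := q`, a
pointed `(r, ε + δ)`-approximation `(X, p) → (Y, q)` for every `r ≥ sup d(·, p)`. (This feeds the
compact theory of `GromovHausdorffApprox.lean` / `EquivariantGHLimit.lean` into the pointed one.)
[folklore] -/
theorem IsGHApprox.isPointedGHApprox_update [DecidableEq X] (hf : IsGHApprox ε f)
    (hX : ∀ x, dist x p ≤ r) :
    IsPointedGHApprox r (ε + dist (f p) q) p q (update f p q) := by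
  have hε : 0 ≤ ε := hf.nonneg p
  have hδ : 0 ≤ dist (f p) q := dist_nonneg
  -- distortion of the updated map against the old one, pointwise
  have hupd : ∀ x, dist (update f p q x) (f x) ≤ dist (f p) q := by
    intro x
    by_cases hx : x = p
    · rw [hx, update_self, dist_comm]
    · rw [update_of_ne hx, dist_self]; exact hδ
  refine ⟨update_self .., fun x₁ _ x₂ _ ↦ ?_, fun y _ ↦ ?_⟩
  · by_cases h₁ : x₁ = p <;> by_cases h₂ : x₂ = p
    · rw [h₁, h₂]; simp only [dist_self, sub_zero, abs_zero]; positivity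
    · rw [h₁, update_self, update_of_ne h₂]
      have h1 := hf.abs_sub_le p x₂
      have h2 : |dist q (f x₂) - dist (f p) (f x₂)| ≤ dist q (f p) := abs_dist_sub_le _ _ _
      rw [dist_comm q (f p)] at h2
      rw [abs_le] at h1 h2 ⊢; constructor <;> linarith [h1.1, h1.2, h2.1, h2.2]
    · rw [h₂, update_self, update_of_ne h₁]
      have h1 := hf.abs_sub_le x₁ p
      have h2 : |dist (f x₁) q - dist (f x₁) (f p)| ≤ dist q (f p) := by
        rw [dist_comm (f x₁) q, dist_comm (f x₁) (f p)]; exact abs_dist_sub_le _ _ _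
      rw [dist_comm q (f p)] at h2
      rw [abs_le] at h1 h2 ⊢; constructor <;> linarith [h1.1, h1.2, h2.1, h2.2]
    · rw [update_of_ne h₁, update_of_ne h₂]
      exact (hf.abs_sub_le x₁ x₂).trans (by linarith)
  · obtain ⟨x, hx⟩ := hf.exists_dist_le y
    refine ⟨x, mem_closedBall.mpr (hX x), ?_⟩
    calc dist (update f p q x) y ≤ dist (update f p q x) (f x) + dist (f x) y := dist_triangle ..
      _ ≤ dist (f p) q + ε := add_le_add (hupd x) hx
      _ = ε + dist (f p) q := add_comm _ _

/-- **Pointed ⇒ absolute** when the balls exhaust the spaces: an `(r, ε)`-approximation with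
`X = B̄(p, r)` and `Y = B̄(q, r - 2ε)` is an `ε`-GH approximation. [folklore] -/
theorem IsPointedGHApprox.isGHApprox (hf : IsPointedGHApprox r ε p q f) (hX : ∀ x, dist x p ≤ r)
    (hY : ∀ y, dist y q ≤ r - 2 * ε) : IsGHApprox ε f :=
  ⟨fun x₁ x₂ ↦ hf.abs_sub_le (mem_closedBall.mpr (hX x₁)) (mem_closedBall.mpr (hX x₂)),
    fun y ↦ (hf.exists_dist_le (mem_closedBall.mpr (hY y))).imp fun _ h ↦ h.2⟩

end Bridge

/-! ### §6. Pointed equivariant approximations and pointed equivariant convergence -/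

section Equivariant

variable {G H X Y : Type*} [Group G] [Group H] [PseudoMetricSpace X] [PseudoMetricSpace Y]
  [MulAction G X] [MulAction H Y]

/-- **Pointed `(r, ε)`-equivariant Gromov–Hausdorff approximation** from the isometric action
`G ↷ (X, p)` to `H ↷ (Y, q)`: a triple `(f, φ, ψ)` with `f` a pointed `(r, ε)`-approximation,
`d(φ(g) • f x, f (g • x)) ≤ ε` for `g ∈ G(r) = {g | d(g • p, p) ≤ r}` and `x ∈ B̄(p, r)`, and
`d(k • f x, f (ψ(k) • x)) ≤ ε` for `k ∈ H(r)`, `x ∈ B̄(p, r)`. Two-parameter form of the printed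
pointed `ε`-eGHA (`IsPointedEpsEquivGHApprox`, radius `1/ε`, strict inequalities), cf.
`IsPointedEpsEquivGHApprox.isPointedEquivGHApprox`. The last clause
`d(ψ(k) • p, p) ≤ d(k • q, q) + ε` is the two-parameter form of the printed codomain condition
`ψ(H(1/ε)) ⊆ G(1/ε)`; the analogous condition for `φ` is automatic,
`d(φ(g) • q, q) ≤ d(g • p, p) + 2ε` (`dist_smul_pt_le`).
[cite: HuangHuangWangZhu2026, §2.1 p. 6] -/
def IsPointedEquivGHApprox (r ε : ℝ) (p : X) (q : Y) (f : X → Y) (φ : G → H) (ψ : H → G) :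
    Prop :=
  IsPointedGHApprox r ε p q f ∧
  (∀ g : G, dist (g • p) p ≤ r → ∀ x ∈ closedBall p r, dist (φ g • f x) (f (g • x)) ≤ ε) ∧
  (∀ k : H, dist (k • q) q ≤ r → ∀ x ∈ closedBall p r, dist (k • f x) (f (ψ k • x)) ≤ ε) ∧
  (∀ k : H, dist (k • q) q ≤ r → dist (ψ k • p) p ≤ dist (k • q) q + ε)

variable {r r' ε ε' : ℝ} {p : X} {q : Y} {f : X → Y} {φ : G → H} {ψ : H → G}

/-- Unfolding lemma. [folklore] -/
theorem isPointedEquivGHApprox_iff : IsPointedEquivGHApprox r ε p q f φ ψ ↔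
    IsPointedGHApprox r ε p q f ∧
    (∀ g : G, dist (g • p) p ≤ r → ∀ x ∈ closedBall p r, dist (φ g • f x) (f (g • x)) ≤ ε) ∧
    (∀ k : H, dist (k • q) q ≤ r → ∀ x ∈ closedBall p r, dist (k • f x) (f (ψ k • x)) ≤ ε) ∧
    (∀ k : H, dist (k • q) q ≤ r → dist (ψ k • p) p ≤ dist (k • q) q + ε) :=
  Iff.rfl

namespace IsPointedEquivGHApprox

/-- The underlying pointed approximation. [folklore] -/
theorem isPointedGHApprox (h : IsPointedEquivGHApprox r ε p q f φ ψ) :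
    IsPointedGHApprox r ε p q f := h.1

/-- Almost-equivariance along `φ`. [folklore] -/
theorem dist_smul_map_le (h : IsPointedEquivGHApprox r ε p q f φ ψ) {g : G}
    (hg : dist (g • p) p ≤ r) {x : X} (hx : x ∈ closedBall p r) :
    dist (φ g • f x) (f (g • x)) ≤ ε := h.2.1 g hg x hx

/-- Almost-equivariance along `ψ`. [folklore] -/
theorem dist_smul_map_le' (h : IsPointedEquivGHApprox r ε p q f φ ψ) {k : H}
    (hk : dist (k • q) q ≤ r) {x : X} (hx : x ∈ closedBall p r) :
    dist (k • f x) (f (ψ k • x)) ≤ ε := h.2.2.1 k hk x hx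

/-- `ψ` almost does not increase displacements: `d(ψ(k) • p, p) ≤ d(k • q, q) + ε` on `H(r)`.
[folklore] -/
theorem dist_smul_pt_le' (h : IsPointedEquivGHApprox r ε p q f φ ψ) {k : H}
    (hk : dist (k • q) q ≤ r) : dist (ψ k • p) p ≤ dist (k • q) q + ε := h.2.2.2 k hk

/-- Restriction / weakening. [folklore] -/
theorem mono (h : IsPointedEquivGHApprox r ε p q f φ ψ) (hr : r' ≤ r) (hε : ε ≤ ε') :
    IsPointedEquivGHApprox r' ε' p q f φ ψ :=
  ⟨h.1.mono hr hε,
    fun _ hg _ hx ↦ (h.dist_smul_map_le (hg.trans hr) (closedBall_subset_closedBall hr hx)).trans hε,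
    fun _ hk _ hx ↦ (h.dist_smul_map_le' (hk.trans hr) (closedBall_subset_closedBall hr hx)).trans
      hε,
    fun _ hk ↦ (h.dist_smul_pt_le' (hk.trans hr)).trans (by linarith)⟩

/-- `φ` moves `G(r)` into `H(r + 2ε)`: `d(φ(g) • q, q) ≤ d(g • p, p) + 2ε`. [folklore] -/
theorem dist_smul_pt_le [IsIsometricSMul G X] (h : IsPointedEquivGHApprox r ε p q f φ ψ) {g : G}
    (hg : dist (g • p) p ≤ r) : dist (φ g • q) q ≤ dist (g • p) p + 2 * ε := by
  have hr : 0 ≤ r := dist_nonneg.trans hg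
  have h1 := h.dist_smul_map_le hg (mem_closedBall_self hr)
  rw [h.1.map_pt] at h1
  have h2 := h.1.dist_map_pt_le (mem_closedBall.mpr hg)
  calc dist (φ g • q) q ≤ dist (φ g • q) (f (g • p)) + dist (f (g • p)) q := dist_triangle ..
    _ ≤ ε + (dist (g • p) p + ε) := add_le_add h1 h2
    _ = dist (g • p) p + 2 * ε := by ring

end IsPointedEquivGHApprox

/-- The identity triple is a pointed `(r, ε)`-equivariant approximation for every `ε ≥ 0`.
Non-vacuity witness. [folklore] -/
theorem isPointedEquivGHApprox_id (hε : 0 ≤ ε) (r : ℝ) (p : X) :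
    IsPointedEquivGHApprox r ε p p (id : X → X) (id : G → G) (id : G → G) :=
  ⟨isPointedGHApprox_id hε r p, fun _ _ _ _ ↦ by simpa using hε, fun _ _ _ _ ↦ by simpa using hε,
    fun _ _ ↦ by simpa using hε⟩

/-- **The printed pointed `ε`-equivariant GH approximation, verbatim** (Huang–Huang–Wang–Zhu 2026,
§2.1 p. 6, after Fukaya–Yamaguchi): with `H(r) = {h ∈ H | d(hp, p) < r}`, a triple `(f, φ, ψ)`,
`f : B_{1/ε}(p) → B_{1/ε+ε}(q)`, `φ : G(1/ε) → H(1/ε)`, `ψ : H(1/ε) → G(1/ε)`, such that `f` is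
a printed `ε`-approximation (`IsPointedEpsGHApprox`), `d(φ(g) f(x), f(gx)) < ε` for all
`g ∈ G(1/ε)`, `x ∈ B_{1/ε}(p)`, and `d(k f(x), f(ψ(k) x)) < ε` for all `k ∈ H(1/ε)`,
`x ∈ B_{1/ε}(p)`. (Maps are taken total; the printed codomain restrictions `φ(G(1/ε)) ⊆ H(1/ε)`,
`ψ(H(1/ε)) ⊆ G(1/ε)` are recorded as the last two clauses.)
[cite: HuangHuangWangZhu2026, §2.1 p. 6] -/
def IsPointedEpsEquivGHApprox (ε : ℝ) (p : X) (q : Y) (f : X → Y) (φ : G → H) (ψ : H → G) :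
    Prop :=
  IsPointedEpsGHApprox ε p q f ∧
  (∀ g : G, dist (g • p) p < 1 / ε → ∀ x ∈ ball p (1 / ε), dist (φ g • f x) (f (g • x)) < ε) ∧
  (∀ k : H, dist (k • q) q < 1 / ε → ∀ x ∈ ball p (1 / ε), dist (k • f x) (f (ψ k • x)) < ε) ∧
  (∀ g : G, dist (g • p) p < 1 / ε → dist (φ g • q) q < 1 / ε) ∧
  (∀ k : H, dist (k • q) q < 1 / ε → dist (ψ k • p) p < 1 / ε)

/-- **Printed ⇒ two-parameter** for equivariant approximations: a printed pointed `ε`-eGHA is a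
pointed `(r, 2ε)`-equivariant approximation for every `r < 1/ε`.
[cite: HuangHuangWangZhu2026, §2.1 p. 6] -/
theorem IsPointedEpsEquivGHApprox.isPointedEquivGHApprox
    (h : IsPointedEpsEquivGHApprox ε p q f φ ψ) (hε : 0 < ε) (hr : r < 1 / ε) :
    IsPointedEquivGHApprox r (2 * ε) p q f φ ψ := by
  have hsub : closedBall p r ⊆ ball p (1 / ε) := closedBall_subset_ball hr
  have hp : p ∈ ball p (1 / ε) := mem_ball_self (by positivity)
  refine ⟨h.1.isPointedGHApprox hε hr, fun g hg x hx ↦ ?_, fun k hk x hx ↦ ?_, fun k hk ↦ ?_⟩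
  · exact (h.2.1 g (hg.trans_lt hr) x (hsub hx)).le.trans (by linarith)
  · exact (h.2.2.1 k (hk.trans_lt hr) x (hsub hx)).le.trans (by linarith)
  · -- `ψ(k) ∈ G(1/ε)` (printed codomain) puts `ψ(k) • p` in the controlled ball
    have hk' : dist (k • q) q < 1 / ε := hk.trans_lt hr
    have hmem : ψ k • p ∈ ball p (1 / ε) := mem_ball.mpr (h.2.2.2.2 k hk')
    have h1 := (abs_le.mp (h.1.2.1 (ψ k • p) hmem p hp)).1
    rw [h.1.1] at h1
    have h2 := (h.2.2.1 k hk' p hp).le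
    rw [h.1.1] at h2
    have h3 := dist_triangle (f (ψ k • p)) (k • q) q
    rw [dist_comm] at h2
    linarith

end Equivariant

section EquivConv

variable {X : ℕ → Type*} [∀ i, PseudoMetricSpace (X i)] {Γ : ℕ → Type*} [∀ i, Group (Γ i)]
  [∀ i, MulAction (Γ i) (X i)] {Y : Type*} [PseudoMetricSpace Y] {G : Type*} [Group G]
  [MulAction G Y]

variable (Γ G) in
/-- **Pointed equivariant Gromov–Hausdorff convergence** `(Xᵢ, pᵢ, Γᵢ) → (Y, q, G)`: for every
`r` and `ε > 0`, for all large `i` there is a pointed `(r, ε)`-equivariant approximation. Implied by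
the printed "`d_eGH → 0`" (`PointedEquivGHConv.of_isPointedEpsEquivGHApprox`).
[cite: HuangHuangWangZhu2026, §2.1 p. 6] -/
def PointedEquivGHConv (p : ∀ i, X i) (q : Y) : Prop :=
  ∀ r ε : ℝ, 0 < ε → ∀ᶠ i in atTop,
    ∃ (f : X i → Y) (φ : Γ i → G) (ψ : G → Γ i), IsPointedEquivGHApprox r ε (p i) q f φ ψ

variable {p : ∀ i, X i} {q : Y}

/-- Unfolding lemma. [folklore] -/
theorem pointedEquivGHConv_iff : PointedEquivGHConv Γ G p q ↔
    ∀ r ε : ℝ, 0 < ε → ∀ᶠ i in atTop,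
      ∃ (f : X i → Y) (φ : Γ i → G) (ψ : G → Γ i), IsPointedEquivGHApprox r ε (p i) q f φ ψ :=
  Iff.rfl

/-- Equivariant convergence forgets to convergence. [folklore] -/
theorem PointedEquivGHConv.pointedGHConv (h : PointedEquivGHConv Γ G p q) : PointedGHConv p q :=
  fun r ε hε ↦ (h r ε hε).mono fun _ ⟨f, _, _, hf⟩ ↦ ⟨f, hf.1⟩

/-- **Printed equivariant convergence implies equivariant convergence.**
[cite: HuangHuangWangZhu2026, §2.1 p. 6] -/
theorem PointedEquivGHConv.of_isPointedEpsEquivGHApprox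
    (h : ∀ ε : ℝ, 0 < ε → ∀ᶠ i in atTop, ∃ (f : X i → Y) (φ : Γ i → G) (ψ : G → Γ i),
      IsPointedEpsEquivGHApprox ε (p i) q f φ ψ) :
    PointedEquivGHConv Γ G p q := by
  intro r ε hε
  obtain ⟨η, hη, hηε, hηr⟩ : ∃ η : ℝ, 0 < η ∧ 2 * η ≤ ε ∧ r < 1 / η := by
    refine ⟨min (ε / 2) (1 / (|r| + 1)), by positivity, ?_, ?_⟩
    · linarith [min_le_left (ε / 2) (1 / (|r| + 1))]
    · have h1 : min (ε / 2) (1 / (|r| + 1)) ≤ 1 / (|r| + 1) := min_le_right _ _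
      have h2 : 0 < min (ε / 2) (1 / (|r| + 1)) := by positivity
      calc r ≤ |r| := le_abs_self r
        _ < |r| + 1 := lt_add_one _
        _ = 1 / (1 / (|r| + 1)) := by rw [one_div_one_div]
        _ ≤ 1 / min (ε / 2) (1 / (|r| + 1)) := one_div_le_one_div_of_le h2 h1
  filter_upwards [h η hη] with i ⟨f, φ, ψ, hf⟩
  exact ⟨f, φ, ψ, (hf.isPointedEquivGHApprox hη hηr).mono le_rfl hηε⟩

/-- Subsequences of an equivariantly convergent sequence converge equivariantly. [folklore] -/
theorem PointedEquivGHConv.subseq (h : PointedEquivGHConv Γ G p q) {φ : ℕ → ℕ}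
    (hφ : StrictMono φ) :
    PointedEquivGHConv (X := fun k ↦ X (φ k)) (fun k ↦ Γ (φ k)) G (fun k ↦ p (φ k)) q :=
  fun r ε hε ↦ hφ.tendsto_atTop.eventually (h r ε hε)

end EquivConv

end Literature.Geometry.MetricGeometry
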